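import Summits.CriticalPhenomena.PercolationContinuityZ3.Theorems.PercNearOneGluingNoHeavyLowerTailKNGenMin
import HarnessLib

/-!
# Kozma–Nitzan's Conjecture 1 for monotone cluster functionals (rank-free, every weight vector)

Support file (`--supports stmt-CriticalPhenomena-4575`), cell perc-kn (req609-KN), file F2, lead `perc-kn-lead` (g0).  No definitions,
no named facts, no sorries; standard axioms.  Statement of record: `Cruxes/NoHeavyLowerTail/Lines/kn_genmin.lean`.

`kn_conjecture1_monotone`: on every finite graph with pair weights in `[0,1]`, for every increasing real `F` on vertex sets, every
nonempty relay set `A` and every vertex `o`, `μ(o ↔ A)·min_{a∈A} E F(C_a) ≤ E[F(C_o); o ↔ A]` — Kozma–Nitzan's Conjecture 1 (the case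
`F = 1{b ∈ ·}`, p. 3) for the monotone cluster properties of their §5.1 (p. 31–32), with no sign hypothesis on `F`.  It is (GENmin)
(`EventGluingSharp.genMin_holds`, file F1) at an `E F(C_·)`-compatible injective rank (`AGloc.exists_rank_compat`).  The registered printed
Conjecture 1 `Literature.StrongHypotheses.CriticalPhenomena.KozmaNitzan2024_conjecture1` is re-derived from it in an `example`
(consistency / non-vacuity; no new name).
[cite: KozmaNitzan2024, Conj. 1 (p. 3), §5.1 (p. 31–32)]
-/

noncomputable section

namespace Summit.CriticalPhenomena.PercolationContinuityZ3.Theorems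

open MeasureTheory Set
open Literature.Probability.LatticeModels (prodBernoulli)
open Literature.Probability.Percolation
open scoped Classical

/-- **Kozma–Nitzan's Conjecture 1 for monotone cluster functionals, rank-free, on every finite weighted graph (weights in `[0,1]`).**
For `F` monotone on vertex sets, `A ≠ ∅` and any `o`:  `μ(o ↔ A)·min_{a∈A} E F(C_a) ≤ ∫_{o ↔ A} F(C_o) dμ`.
(`EventGluingSharp.genMin_holds` with an `E F(C_·)`-compatible injective rank, `AGloc.exists_rank_compat`.)  The printed Conjecture 1
(`F = 1{b ∈ ·}`) is re-derived below. [cite: KozmaNitzan2024, Conj. 1 (p. 3), §5.1 monotone cluster properties (p. 31–32)] -/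
theorem kn_conjecture1_monotone (n : ℕ) (w : Sym2 (Fin n) → unitInterval) (A : Finset (Fin n)) (hA : A.Nonempty) (o : Fin n)
    (F : Set (Fin n) → ℝ) (hF : ∀ S S' : Set (Fin n), S ⊆ S' → F S ≤ F S') :
    (prodBernoulli w).real (⋃ a ∈ A, openConn o a) * A.inf' hA (fun a => ∫ ω, F (openCluster ω a) ∂(prodBernoulli w)) ≤
      ∫ ω in (⋃ a ∈ A, openConn o a), F (openCluster ω o) ∂(prodBernoulli w) := by
  obtain ⟨r, hr, hrc⟩ := AGloc.exists_rank_compat A (fun a => ∫ ω, F (openCluster ω a) ∂(prodBernoulli w))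
  have h := EventGluingSharp.genMin_holds n w A hA o F r hF hr hrc
  exact h.1.trans h.2

/-- Consistency / non-vacuity check: the registered printed Conjecture 1 follows from `kn_conjecture1_monotone` at `F = 1{b ∈ ·}`. -/
example : Literature.StrongHypotheses.CriticalPhenomena.KozmaNitzan2024_conjecture1 := by
  intro n w A o b t ht
  set μ := prodBernoulli w with hμ
  have hmeas : ∀ S : Set (BondConfig (Fin n)), MeasurableSet S := fun S => (Set.toFinite S).measurableSet
  rcases A.eq_empty_or_nonempty with hA | hA
  · rw [hA]
    simp [measureReal_nonneg]
  set F : Set (Fin n) → ℝ := fun M => if b ∈ M then 1 else 0 with hFdef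
  have hFmono : ∀ S T : Set (Fin n), S ⊆ T → F S ≤ F T := by
    intro S T hST
    simp only [hFdef]
    by_cases hS : b ∈ S
    · rw [if_pos hS, if_pos (hST hS)]
    · rw [if_neg hS]
      split_ifs <;> norm_num
  have hFind : ∀ x : Fin n, (fun ω : BondConfig (Fin n) => F (openCluster ω x)) =
      (openConn x b : Set (BondConfig (Fin n))).indicator 1 := by
    intro x
    funext ω
    simp only [hFdef]
    by_cases hω : ω ∈ (openConn x b : Set (BondConfig (Fin n)))
    · rw [Set.indicator_of_mem hω, Pi.one_apply, if_pos (show b ∈ openCluster ω x from hω)]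
    · rw [Set.indicator_of_notMem hω, if_neg (show b ∉ openCluster ω x from hω)]
  have hint : ∀ x : Fin n, ∫ ω, F (openCluster ω x) ∂μ = μ.real (openConn x b) := by
    intro x
    rw [hFind x, integral_indicator_one (hmeas _)]
  have hsetint : ∫ ω in (⋃ a ∈ A, openConn o a), F (openCluster ω o) ∂μ =
      μ.real ((⋃ a ∈ A, openConn o a) ∩ openConn o b : Set (BondConfig (Fin n))) := by
    rw [hFind o, ← integral_indicator (hmeas _), Set.indicator_indicator,
      integral_indicator_one ((hmeas _).inter (hmeas _))]
  have key := kn_conjecture1_monotone n w A hA o F hFmono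
  rw [← hμ] at key
  simp only [hint] at key
  rw [hsetint] at key
  have ht' : t ≤ A.inf' hA (fun a => μ.real (openConn a b)) := by
    rw [Finset.le_inf'_iff]
    exact ht
  calc μ.real (⋃ a ∈ A, openConn o a) * t
      ≤ μ.real (⋃ a ∈ A, openConn o a) * A.inf' hA (fun a => μ.real (openConn a b)) :=
        mul_le_mul_of_nonneg_left ht' measureReal_nonneg
    _ ≤ μ.real ((⋃ a ∈ A, openConn o a) ∩ openConn o b : Set (BondConfig (Fin n))) := key
    _ ≤ μ.real (openConn o b) := measureReal_mono Set.inter_subset_right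


end Summit.CriticalPhenomena.PercolationContinuityZ3.Theorems

end
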